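import Literature.Barriers.CriticalPhenomena.SupercriticalSAWSpaceFillingFamilies
import Literature.Probability.RandomPlanarGeometry.SAWTiles
import Literature.Probability.LatticeModels.LatticeAnimalsGraph
import HarnessLib

/-!
# Supercritical SAW (Duminil-Copin–Kozma–Yadin 2014), Theorem 6 for the disk via odd tiles:
# deep tiles, pushed hole tiles, clear tiles

Disk geometry for the tile form of the proof of Theorem 6 of H. Duminil-Copin, G. Kozma,
A. Yadin, *Supercritical self-avoiding walks are space-filling*, Ann. IHP Probab. Stat. 50
(2014), for `Ω = 𝔻`, with the odd centred tiles `OddTile.tile m r τ` of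
`Literature/Probability/RandomPlanarGeometry/SAWTiles.lean` in place of the printed `m`-boxes
(companion of `SupercriticalSAWSpaceFillingHoles.lean`, whose push map `pushSite` and disk
lemmas are reused):

* `IsDeepTile δ m r Rd τ` — the `ℓ^∞`-ball of radius `Rd` about the tile centre `L τ` lies in
  `𝔻_δ`; `deepTiles` (finite), `IsDeepTile.toward_origin`, `forall_isDeepTile_of_closed` (the
  deep tiles are connected through the origin: "the family of all boxes in `𝔻_δ` is connected
  (it is an interval in every row and every column)").
* `dist_le_l1dist_unitDisk` — graph distances in `𝔻_δ` are at most `ℓ¹` distances (through the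
  corner closest to the origin), so sites far from the walk in the graph metric of Theorem 6 are
  far in `ℓ¹`.
* `holeTile K w = tileOf (pushSite K w)` — the tile assigned to a site of a hole:
  deep (`isDeepTile_holeTile`, for `δ ≤ 1/K²`, `K ≥ Rd + h + 1`), near its site
  (`l1dist_ctr_holeTile_le`), equal or adjacent for adjacent sites (`holeTile_adj_or_eq`), with
  fibres of at most `(2(K+h)+1)²` sites (`card_le_mul_card_image_holeTile`).
* `IsClearTile l ρ τ` — every vertex of the list `l` is at `ℓ¹`-distance `> ρ` from the centre;
  hole tiles of sites at graph distance `≥ ρ + 2K + 2h + 1` from a walk are clear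
  (`isClearTile_holeTile`).
-/

noncomputable section

open Finset Literature.Probability.LatticeModels Literature.Probability.Percolation
  Literature.Probability.RandomPlanarGeometry.SAW

namespace Literature.Barriers.CriticalPhenomena

namespace SupercriticalSAW

variable {m r : ℕ} {δ : ℝ}

/-! ### `ℓ¹` distances: the two conventions -/

/-- The `ℕ`-valued `l1Dist` of `LatticeModels` and the `ℤ`-valued `l1dist` of `SAWTiles` agree.
[folklore] -/
theorem l1Dist_eq_l1dist (x y : Site 2) : (l1Dist 2 x y : ℤ) = l1dist x y := by
  simp [l1Dist, l1dist, Fin.sum_univ_two]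

/-! ### Graph distances in `𝔻_δ` are `ℓ¹` distances -/

/-- The corner of the coordinate box of `p, q` closest to the origin: in each coordinate the one
of `pᵢ, qᵢ` of smaller absolute value. [folklore] -/
def nearCorner (p q : Site 2) : Site 2 := fun i => if |p i| ≤ |q i| then p i else q i

/-- **Graph distances in the discretised disk are `ℓ¹` distances**: any two sites of `𝔻_δ` are
joined in `𝔻_δ` at graph distance at most their `ℓ¹` distance (go monotonically to the corner of
their coordinate box closest to the origin, which is dominated by both, then on).
[folklore] -/
theorem dist_le_l1dist_unitDisk {p q : Site 2} (hp : p ∈ meshDomain unitDisk δ)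
    (hq : q ∈ meshDomain unitDisk δ) :
    (discreteDomainGraph unitDisk δ).Reachable p q ∧
      ((discreteDomainGraph unitDisk δ).dist p q : ℤ) ≤ l1dist p q := by
  set c := nearCorner p q with hc
  -- the box from `p` to `c` is dominated by `p`, the box from `c` to `q` by `q`
  have h1 := reachable_and_dist_le_of_box (δ := δ) c _ p rfl (fun e he => by
    refine mem_meshDomain_unitDisk_of_abs_le hp fun i => ?_
    have := he i
    simp only [hc, nearCorner] at this
    split_ifs at this with h
    · rw [min_self, max_self] at this; rw [le_antisymm this.2 this.1]
    · rw [abs_le]; rw [min_def, max_def] at this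
      push Not at h
      split_ifs at this <;> cases abs_cases (p i) <;> cases abs_cases (q i) <;> constructor <;> omega)
  have h2 := reachable_and_dist_le_of_box (δ := δ) q _ c rfl (fun e he => by
    refine mem_meshDomain_unitDisk_of_abs_le hq fun i => ?_
    have := he i
    simp only [hc, nearCorner] at this
    split_ifs at this with h
    · rw [abs_le]; rw [min_def, max_def] at this
      split_ifs at this <;> cases abs_cases (p i) <;> cases abs_cases (q i) <;> constructor <;> omega
    · rw [min_self, max_self] at this; rw [le_antisymm this.2 this.1])
  refine ⟨h1.1.trans h2.1, ?_⟩
  have h3 := h1.1.dist_triangle_left (G := discreteDomainGraph unitDisk δ) q (v := c)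
  have hsum : (l1Dist 2 p c : ℤ) + l1Dist 2 c q = l1dist p q := by
    rw [l1Dist_eq_l1dist, l1Dist_eq_l1dist]
    simp only [l1dist, hc, nearCorner]
    have key : ∀ i : Fin 2, |p i - (if |p i| ≤ |q i| then p i else q i)| +
        |(if |p i| ≤ |q i| then p i else q i) - q i| = |p i - q i| := fun i => by
      split_ifs <;> simp
    have k0 := key 0; have k1 := key 1
    omega
  have : ((discreteDomainGraph unitDisk δ).dist p q : ℤ) ≤ l1Dist 2 p c + l1Dist 2 c q := by
    have := h3.trans (Nat.add_le_add h1.2 h2.2); exact_mod_cast this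
  omega

/-! ### Deep tiles -/

/-- A tile is deep (with depth radius `Rd`): the `ℓ^∞`-ball of radius `Rd` about its centre lies
in `𝔻_δ`. [cite: DuminilCopinKozmaYadin2014, §3 (m-boxes "included in Ω_δ")] -/
def IsDeepTile (δ : ℝ) (m r Rd : ℕ) (τ : Site 2) : Prop :=
  ∀ w : Site 2, (∀ i, |w i - OddTile.ctr m r τ i| ≤ Rd) → w ∈ meshDomain unitDisk δ

open Classical in
/-- The finite family of deep tiles (all indices lie in `{-⌈1/δ⌉, …, ⌈1/δ⌉}²`). [cite: DuminilCopinKozmaYadin2014, §3 (𝓕(Ω_δ, m))] -/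
def deepTiles (δ : ℝ) (m r Rd : ℕ) : Finset (Site 2) :=
  (box 2 ⌈1 / δ⌉₊).filter (IsDeepTile δ m r Rd)

/-- Sites at `ℓ¹` distance `≤ Rd` from the centre of a deep tile are in the disk. [folklore] -/
theorem IsDeepTile.mem_of_l1dist_le {Rd : ℕ} {τ : Site 2} (h : IsDeepTile δ m r Rd τ) {w : Site 2}
    (hw : l1dist w (OddTile.ctr m r τ) ≤ Rd) : w ∈ meshDomain unitDisk δ := by
  refine h w fun i => ?_
  simp only [l1dist] at hw
  have h0 := abs_nonneg (w 0 - OddTile.ctr m r τ 0)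
  have h1 := abs_nonneg (w 1 - OddTile.ctr m r τ 1)
  fin_cases i
  · show |w 0 - OddTile.ctr m r τ 0| ≤ Rd; omega
  · show |w 1 - OddTile.ctr m r τ 1| ≤ Rd; omega

/-- The centre of a deep tile is in the disk. [folklore] -/
theorem IsDeepTile.ctr_mem {Rd : ℕ} {τ : Site 2} (h : IsDeepTile δ m r Rd τ) :
    OddTile.ctr m r τ ∈ meshDomain unitDisk δ :=
  h _ fun i => by simp

/-- The tile of a deep tile lies in the disk (if `Rd ≥ h`). [folklore] -/
theorem IsDeepTile.tile_subset {Rd : ℕ} {τ : Site 2} (h : IsDeepTile δ m r Rd τ) (hR : OddTile.hw m r ≤ Rd)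
    {w : Site 2} (hw : w ∈ OddTile.tile m r τ) : w ∈ meshDomain unitDisk δ := by
  refine h w fun i => ?_
  have := (OddTile.mem_tile_iff.1 hw) i
  rw [OddTile.ctr_apply, abs_le]; constructor <;> omega

/-- Membership in `deepTiles`: for `δ > 0` these are exactly the deep tiles. [folklore] -/
theorem mem_deepTiles (hδ : 0 < δ) {Rd : ℕ} {τ : Site 2} : τ ∈ deepTiles δ m r Rd ↔ IsDeepTile δ m r Rd τ := by
  classical
  rw [deepTiles, Finset.mem_filter, and_iff_right_iff_imp]
  intro h
  rw [mem_box]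
  intro i
  have habs := abs_lt_of_mem_meshDomain_unitDisk hδ h.ctr_mem i
  simp only [OddTile.ctr_apply, Int.cast_mul, Int.cast_natCast] at habs
  have hL : (1 : ℝ) ≤ (OddTile.side m r : ℝ) := by exact_mod_cast OddTile.side_pos
  have hz : |((τ i : ℤ) : ℝ)| < 1 / δ := by
    refine lt_of_le_of_lt ?_ habs
    rw [abs_mul, abs_of_nonneg (by positivity : (0 : ℝ) ≤ OddTile.side m r)]
    nlinarith [abs_nonneg ((τ i : ℤ) : ℝ)]
  have hlt : |((τ i : ℤ) : ℝ)| < ((⌈1 / δ⌉₊ : ℕ) : ℝ) := hz.trans_le (Nat.le_ceil _)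
  have hlt' : |τ i| < (⌈1 / δ⌉₊ : ℤ) := by exact_mod_cast hlt
  constructor <;> linarith [abs_lt.1 hlt']

/-- **Moving towards the origin keeps a tile deep** (positive coordinate). [cite: DuminilCopinKozmaYadin2014, §3 (proof of Theorem 1 given Theorem 6)] -/
theorem IsDeepTile.sub_single {Rd : ℕ} {τ : Site 2} (h : IsDeepTile δ m r Rd τ) {i : Fin 2} (hi : 0 < τ i) :
    IsDeepTile δ m r Rd (τ - Pi.single i 1) := by
  intro w hw
  have hL := OddTile.side_pos (m := m) (r := r)
  -- the comparison site in the ball about `L τ`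
  set c : Site 2 := Function.update w i (if 0 ≤ w i then w i + OddTile.side m r else OddTile.ctr m r τ i + Rd)
    with hc
  have hcmem : c ∈ meshDomain unitDisk δ := by
    refine h c fun j => ?_
    by_cases hj : j = i
    · subst hj
      have := hw j
      simp only [hc, Function.update_self, OddTile.ctr_apply, Pi.sub_apply, Pi.single_eq_same] at this ⊢
      split_ifs with h0
      · rw [abs_le] at this ⊢; constructor <;> nlinarith
      · simp
    · have := hw j
      simp only [hc, Function.update_of_ne hj, OddTile.ctr_apply, Pi.sub_apply, Pi.single_eq_of_ne hj,
        sub_zero] at this ⊢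
      exact this
  refine mem_meshDomain_unitDisk_of_abs_le hcmem fun j => ?_
  by_cases hj : j = i
  · subst hj
    have := hw j
    simp only [hc, Function.update_self, OddTile.ctr_apply, Pi.sub_apply, Pi.single_eq_same] at this ⊢
    have hLτ : (OddTile.side m r : ℤ) ≤ OddTile.side m r * τ j := by nlinarith
    split_ifs with h0
    · rw [abs_of_nonneg h0, abs_of_nonneg (by omega)]; omega
    · rw [abs_le] at this
      rw [abs_of_neg (not_le.1 h0), abs_of_nonneg (by nlinarith)]
      nlinarith
  · simp [hc, Function.update_of_ne hj]

/-- Moving towards the origin keeps a tile deep (negative coordinate). [cite: DuminilCopinKozmaYadin2014, §3 (proof of Theorem 1 given Theorem 6)] -/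
theorem IsDeepTile.add_single {Rd : ℕ} {τ : Site 2} (h : IsDeepTile δ m r Rd τ) {i : Fin 2} (hi : τ i < 0) :
    IsDeepTile δ m r Rd (τ + Pi.single i 1) := by
  intro w hw
  have hL := OddTile.side_pos (m := m) (r := r)
  set c : Site 2 := Function.update w i (if w i ≤ 0 then w i - OddTile.side m r else OddTile.ctr m r τ i - Rd)
    with hc
  have hcmem : c ∈ meshDomain unitDisk δ := by
    refine h c fun j => ?_
    by_cases hj : j = i
    · subst hj
      have := hw j
      simp only [hc, Function.update_self, OddTile.ctr_apply, Pi.add_apply, Pi.single_eq_same] at this ⊢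
      split_ifs with h0
      · rw [abs_le] at this ⊢; constructor <;> nlinarith
      · simp
    · have := hw j
      simp only [hc, Function.update_of_ne hj, OddTile.ctr_apply, Pi.add_apply, Pi.single_eq_of_ne hj,
        add_zero] at this ⊢
      exact this
  refine mem_meshDomain_unitDisk_of_abs_le hcmem fun j => ?_
  by_cases hj : j = i
  · subst hj
    have := hw j
    simp only [hc, Function.update_self, OddTile.ctr_apply, Pi.add_apply, Pi.single_eq_same] at this ⊢
    have hLτ : OddTile.side m r * τ j ≤ -(OddTile.side m r : ℤ) := by nlinarith
    split_ifs with h0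
    · rw [abs_of_nonpos h0, abs_of_nonpos (by omega)]; omega
    · rw [abs_le] at this
      rw [abs_of_pos (not_le.1 h0), abs_of_nonpos (by nlinarith)]
      nlinarith
  · simp [hc, Function.update_of_ne hj]

/-- **The family of deep tiles is connected through the origin**: a property of tiles closed
under passing to deep `ℤ²`-neighbours and holding at one deep tile holds at every deep tile.
[cite: DuminilCopinKozmaYadin2014, §3 (proof of Theorem 1 given Theorem 6: "the family of all boxes in 𝔻_δ is connected")] -/
theorem forall_isDeepTile_of_closed {Rd : ℕ} {P : Site 2 → Prop}
    (hcl : ∀ τ τ', P τ → (zdGraph 2).Adj τ τ' → IsDeepTile δ m r Rd τ' → P τ')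
    {τ₀ : Site 2} (hP : P τ₀) (hτ₀ : IsDeepTile δ m r Rd τ₀) : ∀ τ, IsDeepTile δ m r Rd τ → P τ := by
  have hadj_add : ∀ (τ : Site 2) (i : Fin 2), (zdGraph 2).Adj τ (τ + Pi.single i 1) := fun τ i =>
    (zdGraph_adj_iff _ _).2 ⟨i, Or.inl rfl⟩
  have hadj_sub : ∀ (τ : Site 2) (i : Fin 2), (zdGraph 2).Adj τ (τ - Pi.single i 1) := fun τ i =>
    (zdGraph_adj_iff _ _).2 ⟨i, Or.inr (by simp)⟩
  -- descend from `τ₀` to the origin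
  have h0 : P 0 := by
    suffices key : ∀ n : ℕ, ∀ τ : Site 2, ∑ i, (τ i).natAbs = n → IsDeepTile δ m r Rd τ → P τ → P 0 from
      key _ τ₀ rfl hτ₀ hP
    intro n
    induction n with
    | zero =>
      intro τ hn _ hPτ
      have : τ = 0 := by
        funext i; exact Int.natAbs_eq_zero.1 (Finset.sum_eq_zero_iff.1 hn i (Finset.mem_univ i))
      exact this ▸ hPτ
    | succ n ih =>
      intro τ hn hτ hPτ
      obtain ⟨i, hi⟩ : ∃ i : Fin 2, τ i ≠ 0 := by
        by_contra hcon; push Not at hcon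
        have : ∑ j, (τ j).natAbs = 0 := Finset.sum_eq_zero fun j _ => by simp [hcon j]
        omega
      rcases lt_or_gt_of_ne hi with hneg | hpos
      · have hτ' := hτ.add_single hneg
        refine ih _ ?_ hτ' (hcl τ _ hPτ (hadj_add τ i) hτ')
        have := sum_natAbs_add_single τ hneg; omega
      · have hτ' := hτ.sub_single hpos
        refine ih _ ?_ hτ' (hcl τ _ hPτ (hadj_sub τ i) hτ')
        have := sum_natAbs_sub_single τ hpos; omega
  -- ascend from the origin
  intro τ hτ
  suffices key : ∀ n : ℕ, ∀ τ : Site 2, ∑ i, (τ i).natAbs = n → IsDeepTile δ m r Rd τ → P τ from key _ τ rfl hτ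
  intro n
  induction n with
  | zero =>
    intro τ hn _
    have : τ = 0 := by
      funext i; exact Int.natAbs_eq_zero.1 (Finset.sum_eq_zero_iff.1 hn i (Finset.mem_univ i))
    exact this ▸ h0
  | succ n ih =>
    intro τ hn hτ
    obtain ⟨i, hi⟩ : ∃ i : Fin 2, τ i ≠ 0 := by
      by_contra hcon; push Not at hcon
      have : ∑ j, (τ j).natAbs = 0 := Finset.sum_eq_zero fun j _ => by simp [hcon j]
      omega
    rcases lt_or_gt_of_ne hi with hneg | hpos
    · have hτ' := hτ.add_single hneg
      have hP' := ih _ (by have := sum_natAbs_add_single τ hneg; omega) hτ'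
      have := hcl _ _ hP' (hadj_sub (τ + Pi.single i 1) i) (by simpa using hτ)
      simpa using this
    · have hτ' := hτ.sub_single hpos
      have hP' := ih _ (by have := sum_natAbs_sub_single τ hpos; omega) hτ'
      have := hcl _ _ hP' (hadj_add (τ - Pi.single i 1) i) (by simpa using hτ)
      simpa using this

/-- The origin tile is deep as soon as any tile is. [folklore] -/
theorem isDeepTile_zero {Rd : ℕ} {τ₀ : Site 2} (h : IsDeepTile δ m r Rd τ₀) : IsDeepTile δ m r Rd 0 := by
  suffices key : ∀ n : ℕ, ∀ τ : Site 2, ∑ i, (τ i).natAbs = n → IsDeepTile δ m r Rd τ → IsDeepTile δ m r Rd 0 from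
    key _ τ₀ rfl h
  intro n
  induction n with
  | zero =>
    intro τ hn hτ
    have : τ = 0 := by
      funext i; exact Int.natAbs_eq_zero.1 (Finset.sum_eq_zero_iff.1 hn i (Finset.mem_univ i))
    exact this ▸ hτ
  | succ n ih =>
    intro τ hn hτ
    obtain ⟨i, hi⟩ : ∃ i : Fin 2, τ i ≠ 0 := by
      by_contra hcon; push Not at hcon
      have : ∑ j, (τ j).natAbs = 0 := Finset.sum_eq_zero fun j _ => by simp [hcon j]
      omega
    rcases lt_or_gt_of_ne hi with hneg | hpos
    · exact ih _ (by have := sum_natAbs_add_single τ hneg; omega) (hτ.add_single hneg)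
    · exact ih _ (by have := sum_natAbs_sub_single τ hpos; omega) (hτ.sub_single hpos)

/-! ### Tiles of adjacent sites -/

/-- The tile index is monotone and `1`-Lipschitz under unit steps. [folklore] -/
theorem tileIdx_add_one (z : ℤ) :
    OddTile.tileIdx m r (z + 1) = OddTile.tileIdx m r z ∨ OddTile.tileIdx m r (z + 1) = OddTile.tileIdx m r z + 1 := by
  have h1 := OddTile.tileIdx_spec (m := m) (r := r) z
  by_cases h : z + 1 ≤ (OddTile.side m r : ℤ) * OddTile.tileIdx m r z + OddTile.hw m r
  · exact Or.inl (OddTile.tileIdx_eq ⟨by omega, h⟩)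
  · right
    apply OddTile.tileIdx_eq
    rw [OddTile.side_eq] at h h1 ⊢
    constructor <;> nlinarith

/-- **Adjacent sites lie in equal or adjacent tiles.** [folklore] -/
theorem tileOf_adj_or_eq {w w' : Site 2} (h : (zdGraph 2).Adj w w') :
    OddTile.tileOf m r w = OddTile.tileOf m r w' ∨ (zdGraph 2).Adj (OddTile.tileOf m r w) (OddTile.tileOf m r w') := by
  suffices key : ∀ (w : Site 2) (i : Fin 2), OddTile.tileOf m r w = OddTile.tileOf m r (w + Pi.single i 1) ∨
      (zdGraph 2).Adj (OddTile.tileOf m r w) (OddTile.tileOf m r (w + Pi.single i 1)) by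
    obtain ⟨i, rfl | rfl⟩ := (zdGraph_adj_iff _ _).1 h
    · exact key w i
    · rcases key w' i with h' | h'
      · exact Or.inl h'.symm
      · exact Or.inr h'.symm
  intro w i
  rcases tileIdx_add_one (m := m) (r := r) (w i) with h' | h'
  · left; funext j
    by_cases hj : j = i
    · subst hj; simp [OddTile.tileOf, h']
    · simp [OddTile.tileOf, Pi.single_eq_of_ne hj]
  · right
    rw [zdGraph_adj_iff]
    refine ⟨i, Or.inl ?_⟩
    funext j
    by_cases hj : j = i
    · subst hj; simp [OddTile.tileOf, h']
    · simp [OddTile.tileOf, Pi.single_eq_of_ne hj]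

/-! ### The tile of a pushed site -/

/-- The tile assigned to a site of a hole: the tile of the site pushed `K` steps towards the
origin. [cite: DuminilCopinKozmaYadin2014, §3 (proof of Theorem 6: boxes covering the hole S)] -/
def holeTile (m r K : ℕ) (w : Site 2) : Site 2 := OddTile.tileOf m r (pushSite K w)

/-- A hole tile is near its site. [folklore] -/
theorem l1dist_ctr_holeTile_le (K : ℕ) (w : Site 2) :
    l1dist w (OddTile.ctr m r (holeTile m r K w)) ≤ 2 * K + 2 * OddTile.hw m r := by
  have h1 := l1Dist_pushSite_le K w
  have h1' : l1dist w (pushSite K w) ≤ 2 * K := by rw [← l1Dist_eq_l1dist]; exact_mod_cast h1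
  have h2 := OddTile.l1dist_ctr_le_of_mem_tile (OddTile.mem_tile_tileOf (m := m) (r := r) (pushSite K w))
  simp only [l1dist, holeTile] at h1' h2 ⊢
  have := abs_sub_le (w 0) (pushSite K w 0) (OddTile.ctr m r (OddTile.tileOf m r (pushSite K w)) 0)
  have := abs_sub_le (w 1) (pushSite K w 1) (OddTile.ctr m r (OddTile.tileOf m r (pushSite K w)) 1)
  omega

/-- **Adjacent sites have equal or adjacent hole tiles.** [cite: DuminilCopinKozmaYadin2014, §3 (proof of Theorem 6: "a connected family of … boxes … covering S")] -/
theorem holeTile_adj_or_eq (K : ℕ) {w w' : Site 2} (h : (zdGraph 2).Adj w w') :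
    holeTile m r K w = holeTile m r K w' ∨ (zdGraph 2).Adj (holeTile m r K w) (holeTile m r K w') := by
  suffices key : ∀ (w : Site 2) (i : Fin 2), holeTile m r K w = holeTile m r K (w + Pi.single i 1) ∨
      (zdGraph 2).Adj (holeTile m r K w) (holeTile m r K (w + Pi.single i 1)) by
    obtain ⟨i, rfl | rfl⟩ := (zdGraph_adj_iff _ _).1 h
    · exact key w i
    · rcases key w' i with h' | h'
      · exact Or.inl h'.symm
      · exact Or.inr h'.symm
  intro w i
  unfold holeTile
  rcases pushSite_add_single K w i with h' | h'
  · left; rw [h']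
  · rw [h']
    exact tileOf_adj_or_eq ((zdGraph_adj_iff _ _).2 ⟨i, Or.inl rfl⟩)

/-- **The hole tile is deep** once `δ ≤ 1/K²`, `K ≥ Rd + h + 1`, `K ≥ 2`: pushing a site of `𝔻_δ`
`K` steps towards the origin leaves room for the `Rd`-ball of its tile inside the disk.
[cite: DuminilCopinKozmaYadin2014, §3 (proof of Theorem 6)] -/
theorem isDeepTile_holeTile {Rd K : ℕ} (hK : Rd + OddTile.hw m r + 1 ≤ K) (hK2 : 2 ≤ K) (hδ : 0 < δ)
    (hδ' : δ ≤ 1 / (K : ℝ) ^ 2) {w : Site 2} (hw : w ∈ meshDomain unitDisk δ) :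
    IsDeepTile δ m r Rd (holeTile m r K w) := by
  intro c hc
  have hp := OddTile.mem_tile_iff.1 (OddTile.mem_tile_tileOf (m := m) (r := r) (pushSite K w))
  -- integer bookkeeping, coordinate by coordinate
  have key : ∀ i, (|c i| + 1 ≤ |w i|) ∨ (|c i| + 1 ≤ (K : ℤ) ∧ |w i| < K) := by
    intro i
    have h1 := hp i
    have h2 := hc i
    simp only [holeTile, OddTile.ctr_apply] at h2
    simp only [pushSite] at h1 h2
    rw [abs_le] at h2
    rw [abs_eq_max_neg, abs_eq_max_neg, max_def, max_def]
    split_ifs at h1 h2 with ha hb <;> split_ifs <;> omega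
  rw [mem_meshDomain_unitDisk_iff_lt_sq hδ, Fin.sum_univ_two] at hw ⊢
  have hKR : (2 : ℝ) ≤ (K : ℝ) := by exact_mod_cast hK2
  have hρ : ((K : ℝ)) ^ 2 ≤ 1 / δ := by
    rw [le_div_iff₀ hδ]
    calc (K : ℝ) ^ 2 * δ ≤ (K : ℝ) ^ 2 * (1 / (K : ℝ) ^ 2) := mul_le_mul_of_nonneg_left hδ' (by positivity)
      _ = 1 := by field_simp
  have cast_key : ∀ i, (|((c i : ℤ) : ℝ)| + 1 ≤ |((w i : ℤ) : ℝ)|) ∨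
      (|((c i : ℤ) : ℝ)| + 1 ≤ (K : ℝ) ∧ |((w i : ℤ) : ℝ)| < K) := by
    intro i
    rcases key i with h | ⟨h, h'⟩
    · left; exact_mod_cast h
    · right; exact ⟨by exact_mod_cast h, by exact_mod_cast h'⟩
  have hS : |((w 0 : ℤ) : ℝ)| ^ 2 + |((w 1 : ℤ) : ℝ)| ^ 2 < (1 / δ) ^ 2 := by simpa only [sq_abs] using hw
  have := sq_add_sq_lt_of_push hKR hρ (abs_nonneg _) (abs_nonneg _) (abs_nonneg _) (abs_nonneg _)
    hS (cast_key 0) (cast_key 1)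
  simpa only [sq_abs] using this

/-- Fibres of the hole tile map are small: the sites with a given hole tile lie in a square of
side `2(K + h) + 1`. [cite: DuminilCopinKozmaYadin2014, §3 (proof of Theorem 6: "at least s/(2m+1)² boxes")] -/
theorem card_filter_holeTile_le (K : ℕ) (S : Finset (Site 2)) (τ : Site 2) :
    (S.filter fun w => holeTile m r K w = τ).card ≤ (2 * (K + OddTile.hw m r) + 1) ^ 2 := by
  classical
  set T : Finset (Site 2) := Fintype.piFinset fun i =>
    Finset.Icc (OddTile.ctr m r τ i - (K + OddTile.hw m r)) (OddTile.ctr m r τ i + (K + OddTile.hw m r)) with hT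
  have hsub : (S.filter fun w => holeTile m r K w = τ) ⊆ T := by
    intro w hw
    rw [Finset.mem_filter] at hw
    rw [hT, Fintype.mem_piFinset]
    intro i
    rw [Finset.mem_Icc]
    have h1 := abs_sub_pushSite_le K w i
    have h2 := OddTile.mem_tile_iff.1 (OddTile.mem_tile_tileOf (m := m) (r := r) (pushSite K w)) i
    rw [← hw.2]; simp only [holeTile, OddTile.ctr_apply] at h2 ⊢
    rw [abs_le] at h1
    constructor <;> omega
  refine (Finset.card_le_card hsub).trans ?_
  rw [hT, Fintype.card_piFinset, Fin.prod_univ_two, Int.card_Icc, Int.card_Icc, sq]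
  apply Nat.mul_le_mul <;> omega

/-- Hence a finite set of sites has at least `#S / (2(K+h)+1)²` distinct hole tiles. [cite: DuminilCopinKozmaYadin2014, §3 (proof of Theorem 6)] -/
theorem card_le_mul_card_image_holeTile (K : ℕ) (S : Finset (Site 2)) :
    S.card ≤ (2 * (K + OddTile.hw m r) + 1) ^ 2 * (S.image (holeTile m r K)).card := by
  classical
  exact Finset.card_le_mul_card_image _ _ fun τ _ => card_filter_holeTile_le K S τ

/-! ### Clear tiles -/

/-- A tile is clear of the list `l` (radius `ρ`): every vertex of `l` is at `ℓ¹`-distance `> ρ`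
from its centre. [cite: DuminilCopinKozmaYadin2014, §3 (boxes "disjoint from γ_δ")] -/
def IsClearTile (m r : ℕ) (l : List (Site 2)) (ρ : ℤ) (τ : Site 2) : Prop :=
  ∀ g ∈ l, ρ < l1dist g (OddTile.ctr m r τ)

/-- Clear tiles are decidable. [folklore] -/
instance (m r : ℕ) (l : List (Site 2)) (ρ : ℤ) (τ : Site 2) : Decidable (IsClearTile m r l ρ τ) := by
  unfold IsClearTile; infer_instance

/-- A clear tile (radius `ρ ≥ 2h`) contains no vertex of the list. [folklore] -/
theorem IsClearTile.not_mem {l : List (Site 2)} {ρ : ℤ} {τ : Site 2} (h : IsClearTile m r l ρ τ)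
    (hρ : 2 * (OddTile.hw m r : ℤ) ≤ ρ) {w : Site 2} (hw : w ∈ OddTile.tile m r τ) : w ∉ l := fun hl => by
  have h1 := h w hl
  have h2 := OddTile.l1dist_ctr_le_of_mem_tile hw
  omega

/-- **Hole tiles are clear**: if `w ∈ 𝔻_δ` is at graph distance `≥ ρ + 2K + 2h + 1` from every
vertex of a walk in `𝔻_δ`, its hole tile is clear of the walk with radius `ρ`.
[cite: DuminilCopinKozmaYadin2014, §3 (proof of Theorem 6: "Every box intersecting S must be disjoint from γ_δ")] -/
theorem isClearTile_holeTile {K : ℕ} {ρ : ℤ} {l : List (Site 2)} {w : Site 2} (hw : w ∈ meshDomain unitDisk δ)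
    (hl : ∀ g ∈ l, g ∈ meshDomain unitDisk δ)
    (hfar : ∀ g ∈ l, ρ + 2 * K + 2 * OddTile.hw m r + 1 ≤ ((discreteDomainGraph unitDisk δ).dist g w : ℤ)) :
    IsClearTile m r l ρ (holeTile m r K w) := by
  intro g hg
  have h1 := (dist_le_l1dist_unitDisk (hl g hg) hw).2
  have h2 := l1dist_ctr_holeTile_le (m := m) (r := r) K w
  have h3 := hfar g hg
  simp only [l1dist] at h1 h2 ⊢
  -- `l1(g, ctr) ≥ l1(g, w) - l1(w, ctr)`
  have := abs_sub_le (g 0) (OddTile.ctr m r (holeTile m r K w) 0) (w 0)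
  have := abs_sub_le (g 1) (OddTile.ctr m r (holeTile m r K w) 1) (w 1)
  have := abs_sub_comm (w 0) (OddTile.ctr m r (holeTile m r K w) 0)
  have := abs_sub_comm (w 1) (OddTile.ctr m r (holeTile m r K w) 1)
  omega

end SupercriticalSAW

end Literature.Barriers.CriticalPhenomena
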